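import Summits.BirchSwinnertonDyer.Rank1Residual.Additive.KatoDescentKummerUnramifiedLimit
import Summits.BirchSwinnertonDyer.BirchSwinnertonDyer.Theorems.ErratumRoadFiveKatoFframeDoorLift
import HarnessLib

set_option autoImplicit false

/-!
# Route `ErratumRoadFive`, crux 19715 `EulerHalfNotRamNoInertSetAtFive`, line `kato_Fframe` (r5.4), stub S1Λ
# `stub_katoLambdaLogBoundTamagawa` — HELPER R-C re-thread A: Parts 24 §3 / 25 / 26 of cell bsd-cm with the ADDITIVITY hypothesis
# `hQadd` replaced by the LOCAL BINDERS (I) (local index) and (L) (door lift)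

Seat `bsd-line-er5-p1` (LEAD g9), `--supports stmt-BirchSwinnertonDyer-19715` (helper). Theorems only: no definition, no named
fact, no instance, no notation, no `sorry`. `K : Type`. No summit statement is proved here; BSD is proved for no curve.

The bsd-cm chain `Rank1Residual/Additive/KatoDescentKummerUnramified{LocalIndex,CountTamagawa,Limit}.lean` (Parts 24–26) proves (R1-d)
at finite level and its passage to `E[p^∞]` for a finite set `Σ` of ADDITIVE places `v ∤ p`.  Additivity enters only through
(A) the local index `[𝓚_v ⊔ H¹_ur : 𝓚_v] = p^{v_p c_v}` (Part 24 §2) and (D) the door `ι_{k,v}⁻¹(H¹_ur(E[p^∞])) = H¹_ur(E[p^k]) ⊔ 𝓚_v`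
(n1011's `…_of_inertia_torsion`).  THIS FILE re-runs Parts 24 §3, 25, 26 §2 and 26 §4 VERBATIM with (A) and (D) taken as the binders
(I) `hidx` and (L) `hlift` of the LEAD brief `Cruxes/EulerHalfNotRamNoInertSetAtFive/Lines/kato_Fframe_r5_RC_rethread_brief.md`
(door: g40's `ErratumRoadFiveKatoFframeDoorLift.comap_map_unramifiedSubgroup_eq_sup_ker_of_lift`).  Both binders are THEOREMS at every
finite `v ∤ p` (`ErratumRoadFiveKatoFframeLocalIndex`, `ErratumRoadFiveKatoFframeLocalLift`); they are kept as hypotheses here so that the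
re-thread is reduction-type-free and import-light, and discharged in the closer.

* §1 `exists_forall_le_prod_relIndex_kummer_sup_unramified_eq_of_local` (Part 24 §3′), §2 `exists_forall_le_relIndex_selmerGroup_eq_prod_of_local`
  (Part 25′), §3 `localization_mem_kummer_sup_unramified_iff_of_lift`, `selmerGroup_kummerSupUnramified_eq_comap_of_lift` (Part 26 §2′),
  §4 `exists_forall_le_relIndex_selmerGroupPInfty_mul_relIndex_eq_of_local` (Part 26 §4′).

References: [Rubin2000] Thm. 1.7.3; [Kato2004Asterisque] §14.8 (p. 238), (14.9.3) (p. 240); [GreenbergLNM1716] §2 (pp. 72–74), §4 (p. 74),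
§5 (p. 114); [MilneADT2006] Ch. I Prop. 3.8, Thm. 4.10; [SilvermanAEC2009] Thm. VII.6.1.
-/

noncomputable section

open scoped Classical ContRepresentation NumberField
open Function Field NumberField IsDedekindDomain WeierstrassCurve
open Literature.NumberTheory.EllipticCurves Literature.NumberTheory.GaloisRepresentations
  Literature.NumberTheory.GaloisRepresentations.DiscreteGaloisModule Literature.NumberTheory.GaloisCohomology
open Summit.BirchSwinnertonDyer.Rank1Residual.X11b.Levels Summit.BirchSwinnertonDyer.Rank1Residual.X11b.LocBridge
open Summit.BirchSwinnertonDyer.Rank1Residual.Additive.KummerUnramified Summit.BirchSwinnertonDyer.Rank1Residual.GaloisImage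
open Summit.BirchSwinnertonDyer.BirchSwinnertonDyer.Theorems.ErratumRoadFiveKatoFframeDoorLift

set_option linter.dupNamespace false

namespace Summit.BirchSwinnertonDyer.BirchSwinnertonDyer.Theorems.ErratumRoadFiveKatoFframeKummerUnramifiedBad

variable {K : Type} [Field K] [NumberField K] (W : WeierstrassCurve K) [W.IsElliptic] (p : ℕ) [hp : Fact p.Prime]

/-! ## §1 Part 24 §3′: the product of the local indices over `Σ`, from binder (I) -/

omit [W.IsElliptic] hp in
/-- **`∃ k₀, ∀ k ≥ k₀: ∏_{v∈Σ} [𝓚_v ⊔ H¹_ur(K_v, E[p^k]) : 𝓚_v] = ∏_{v∈Σ} p^{v_p(c_v)}`** from the per-place statements (binder (I)); the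
constant `C′ = ∏ c_v^{(p)}` of (R1-d). [cite: Rubin2000, Thm. 1.7.3] [cite: GreenbergLNM1716, §4 proof of Thm. 4.1 (p. 74)] -/
theorem exists_forall_le_prod_relIndex_kummer_sup_unramified_eq_of_local (Q : Finset (HeightOneSpectrum (𝓞 K)))
    (hidx : ∀ v ∈ Q, ∃ k₁ : ℕ, ∀ k, k₁ ≤ k →
      (W.kummerSelmerStructure ((p ^ k : ℕ) : ℤ) (Sum.inr v)).relIndex
          (W.kummerSelmerStructure ((p ^ k : ℕ) : ℤ) (Sum.inr v) ⊔
            unramifiedSubgroup (GaloisRep.toLocal v (W.torsionGaloisModule ((p ^ k : ℕ) : ℤ))) 1) =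
        p ^ padicValNat p ((W.baseChange (v.adicCompletion K)).localTamagawaNumber (v.adicCompletionIntegers K))) :
    ∃ k₀ : ℕ, ∀ k, k₀ ≤ k →
      ∏ v ∈ Q, (W.kummerSelmerStructure ((p ^ k : ℕ) : ℤ) (Sum.inr v)).relIndex
          (W.kummerSelmerStructure ((p ^ k : ℕ) : ℤ) (Sum.inr v) ⊔
            unramifiedSubgroup (GaloisRep.toLocal v (W.torsionGaloisModule ((p ^ k : ℕ) : ℤ))) 1) =
        ∏ v ∈ Q, p ^ padicValNat p ((W.baseChange (v.adicCompletion K)).localTamagawaNumber (v.adicCompletionIntegers K)) := by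
  classical
  choose! f hf using hidx
  exact ⟨Q.sup f, fun k hk => Finset.prod_congr rfl fun v hv => hf v hv k ((Finset.le_sup hv).trans hk)⟩

/-! ## §2 Part 25′: `[H¹_𝓖 : H¹_{𝓖'}] = ∏_{v∈Σ} p^{v_p(c_v)}` for `k ≫ 0`, from binder (I) -/

/-- **(R1-d) at finite level, evaluated, reduction-type-free at `Σ`**: `∃ k₀ ≥ 1, ∀ k ≥ k₀`, for all `𝓖`, `𝓖'` of the shape «Kummer ⊔
unramified resp. Kummer ⊓ unramified at `Σ`, Kummer at the other finite places»: `H¹_{𝓖'} ≤ H¹_𝓖` and `[H¹_𝓖 : H¹_{𝓖'}] = ∏_{v∈Σ} p^{v_p(c_v)}`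
— `p` odd, `Σ ⊆ T` finite places `∤ p` with binder (I), `T ⊇ {v ∣ p} ∪ {bad}` (Part 23 discharged + §1).
[cite: Rubin2000, Thm. 1.7.3] [cite: Kato2004Asterisque, §14.8 (p. 238) and (14.9.3) (p. 240)] [cite: MilneADT2006, Ch. I, Thm. 4.10] -/
theorem exists_forall_le_relIndex_selmerGroup_eq_prod_of_local (hodd : p ≠ 2)
    (Q T : Finset (HeightOneSpectrum (𝓞 K))) (hQT : Q ⊆ T)
    (hQp : ∀ v ∈ Q, ((p : ℕ) : 𝓞 K) ∉ v.asIdeal)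
    (hidx : ∀ v ∈ Q, ∃ k₁ : ℕ, ∀ k, k₁ ≤ k →
      (W.kummerSelmerStructure ((p ^ k : ℕ) : ℤ) (Sum.inr v)).relIndex
          (W.kummerSelmerStructure ((p ^ k : ℕ) : ℤ) (Sum.inr v) ⊔
            unramifiedSubgroup (GaloisRep.toLocal v (W.torsionGaloisModule ((p ^ k : ℕ) : ℤ))) 1) =
        p ^ padicValNat p ((W.baseChange (v.adicCompletion K)).localTamagawaNumber (v.adicCompletionIntegers K)))
    (hTp : ∀ v : HeightOneSpectrum (𝓞 K), ((p : ℕ) : 𝓞 K) ∈ v.asIdeal → v ∈ T)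
    (hTbad : ∀ v : HeightOneSpectrum (𝓞 K), ¬ W.HasGoodReductionAt v → v ∈ T) :
    ∃ k₀ : ℕ, 1 ≤ k₀ ∧ ∀ k, k₀ ≤ k →
      ∀ (𝓖 𝓖' : SelmerStructure (W.torsionGaloisModule ((p ^ k : ℕ) : ℤ))),
        (∀ v ∈ Q, 𝓖 (Sum.inr v) = W.kummerSelmerStructure ((p ^ k : ℕ) : ℤ) (Sum.inr v) ⊔
          unramifiedSubgroup (GaloisRep.toLocal v (W.torsionGaloisModule ((p ^ k : ℕ) : ℤ))) 1) →
        (∀ v ∉ Q, 𝓖 (Sum.inr v) = W.kummerSelmerStructure ((p ^ k : ℕ) : ℤ) (Sum.inr v)) →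
        (∀ v ∈ Q, 𝓖' (Sum.inr v) = W.kummerSelmerStructure ((p ^ k : ℕ) : ℤ) (Sum.inr v) ⊓
          unramifiedSubgroup (GaloisRep.toLocal v (W.torsionGaloisModule ((p ^ k : ℕ) : ℤ))) 1) →
        (∀ v ∉ Q, 𝓖' (Sum.inr v) = W.kummerSelmerStructure ((p ^ k : ℕ) : ℤ) (Sum.inr v)) →
        (∀ w : InfinitePlace K, 𝓖' (Sum.inl w) ≤ 𝓖 (Sum.inl w)) →
        𝓖'.selmerGroup ≤ 𝓖.selmerGroup ∧
          𝓖'.selmerGroup.relIndex 𝓖.selmerGroup =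
            ∏ v ∈ Q, p ^ padicValNat p
              ((W.baseChange (v.adicCompletion K)).localTamagawaNumber (v.adicCompletionIntegers K)) := by
  obtain ⟨k₁, hk₁⟩ := exists_forall_le_prod_relIndex_kummer_sup_unramified_eq_of_local W p Q hidx
  refine ⟨max 1 k₁, le_max_left _ _, fun k hk 𝓖 𝓖' h𝓖Q h𝓖nQ h𝓖'Q h𝓖'nQ h𝓖'inl => ?_⟩
  obtain ⟨hle, hidx'⟩ := relIndex_selmerGroup_kummerInfUnramified_eq_of_prime_pow W p k hodd
    (le_trans (le_max_left _ _) hk) Q T hQT hQp hTp hTbad 𝓖 𝓖' h𝓖Q h𝓖nQ h𝓖'Q h𝓖'nQ h𝓖'inl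
  exact ⟨hle, hidx'.trans (hk₁ k (le_trans (le_max_right _ _) hk))⟩

/-! ## §3 Part 26 §2′: the relaxed structure `H¹_{𝓚 ⊔ ur@Σ}(K, E[p^k]) = ι_k⁻¹ S_Σ`, from the level-`k` lift hypothesis (L) -/

/-- **At a finite `v ∤ p` with the door-lift hypothesis at level `p^k`: `loc_v y ∈ 𝓚_v ⊔ H¹_ur(K_v, E[p^k])` iff
`loc_v (ι_k y) ∈ H¹_ur(K_v, E[p^∞])`** — g40's door `ι_{k,v}⁻¹(H¹_ur) = H¹_ur ⊔ ker ι_{k,v}` under `hlift`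
(`comap_map_unramifiedSubgroup_eq_sup_ker_of_lift`), `ker ι_{k,v} = 𝓚_v` (X11b), and `loc_v ∘ ι_k = ι_{k,v} ∘ loc_v`.
[cite: GreenbergLNM1716, §2 (pp. 72–74)] [cite: MilneADT2006, Ch. I, Prop. 3.8] -/
theorem localization_mem_kummer_sup_unramified_iff_of_lift (k : ℕ) (v : HeightOneSpectrum (𝓞 K))
    (hpv : ((p : ℕ) : 𝓞 K) ∉ v.asIdeal)
    (hliftk : ∀ y : W.geomPrimaryTorsion p,
      (∀ τ ∈ absInertia (v.adicCompletion K),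
        GaloisRep.restrictField (v.adicCompletion K) (primaryGaloisModule W p) τ y = y) →
      (∀ σ : absoluteGaloisGroup (v.adicCompletion K), ∃ z : W.geomPrimaryTorsion p,
        (∀ τ ∈ absInertia (v.adicCompletion K),
          GaloisRep.restrictField (v.adicCompletion K) (primaryGaloisModule W p) τ z = z) ∧
        GaloisRep.restrictField (v.adicCompletion K) (primaryGaloisModule W p) σ y - y = p ^ k • z) →
      ∃ m : W.geomPrimaryTorsion p,
        (∀ σ : absoluteGaloisGroup (v.adicCompletion K),
          GaloisRep.restrictField (v.adicCompletion K) (primaryGaloisModule W p) σ m = m) ∧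
        ∃ z : W.geomPrimaryTorsion p,
          (∀ τ ∈ absInertia (v.adicCompletion K),
            GaloisRep.restrictField (v.adicCompletion K) (primaryGaloisModule W p) τ z = z) ∧
          y - m = p ^ k • z)
    (y : galH1Torsion W ((p ^ k : ℕ) : ℤ)) :
    galoisCohomology.localization (W.torsionGaloisModule ((p ^ k : ℕ) : ℤ)) (Sum.inr v) 1 y ∈
        W.kummerSelmerStructure ((p ^ k : ℕ) : ℤ) (Sum.inr v) ⊔
          unramifiedSubgroup (GaloisRep.toLocal v (W.torsionGaloisModule ((p ^ k : ℕ) : ℤ))) 1 ↔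
      galoisCohomology.localization (primaryGaloisModule W p) (Sum.inr v) 1
          (galoisCohomology.map (primaryInclusion W p k) 1 y) ∈
        unramifiedSubgroup (GaloisRep.toLocal v (primaryGaloisModule W p)) 1 := by
  have hn : ((p ^ k : ℕ) : ℤ) ≠ 0 := by exact_mod_cast pow_ne_zero k hp.out.ne_zero
  have hdoor := comap_map_unramifiedSubgroup_eq_sup_ker_of_lift
    (ρA := GaloisRep.restrictField (v.adicCompletion K) (W.torsionGaloisModule ((p ^ k : ℕ) : ℤ)))
    (ρB := GaloisRep.restrictField (v.adicCompletion K) (primaryGaloisModule W p))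
    (exists_primaryInclusion_restrictField_eq_of_nsmul_eq_zero W p k (v.adicCompletion K))
    (primaryInclusion_restrictField_injective W p k (v.adicCompletion K))
    (pow_nsmul_geomTorsion_eq_zero W p k) hliftk
  have hker : (galoisCohomology.map ((primaryInclusion W p k).restrictField (v.adicCompletion K)) 1).ker =
      W.kummerSelmerStructure ((p ^ k : ℕ) : ℤ) (Sum.inr v) :=
    (Summit.BirchSwinnertonDyer.Rank1Residual.X11b.LevelKummer.kummerLocalConditionAt_eq_ker_map_primaryInclusion W p k v hpv hn).symm
  rw [localization_map_one', ← AddSubgroup.mem_comap]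
  change _ ↔ _ ∈ (DiscreteGaloisModule.unramifiedSubgroup
    (GaloisRep.restrictField (v.adicCompletion K) (primaryGaloisModule W p)) 1).comap
      (galoisCohomology.map ((primaryInclusion W p k).restrictField (v.adicCompletion K)) 1)
  rw [hdoor, hker, sup_comm]
  rfl

/-- **`H¹_{𝓚 ⊔ ur@Σ}(K, E[p^k]) = ι_k⁻¹ S_Σ`** under the level-`p^k` door-lift hypothesis at every `v ∈ Σ` (finite places `∤ p`):
`𝓖` any Selmer structure «`𝓚 ⊔ H¹_ur` at `Σ`, `𝓚` elsewhere», `S_Σ ≤ H¹(K, E[p^∞])` ANY subgroup cut out by «`p^∞`-Selmer local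
kernel off `Σ`, unramified at `Σ`» (Kato's `S(T)`). Part 26 §2 verbatim with the door of §3.
[cite: Kato2004Asterisque, §14.8 (p. 238)] [cite: GreenbergLNM1716, §5 proof of Prop. 5.8 (p. 114)] -/
theorem selmerGroup_kummerSupUnramified_eq_comap_of_lift (k : ℕ) (Q : Finset (HeightOneSpectrum (𝓞 K)))
    (hQp : ∀ v ∈ Q, ((p : ℕ) : 𝓞 K) ∉ v.asIdeal)
    (hliftk : ∀ v ∈ Q, ∀ y : W.geomPrimaryTorsion p,
      (∀ τ ∈ absInertia (v.adicCompletion K),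
        GaloisRep.restrictField (v.adicCompletion K) (primaryGaloisModule W p) τ y = y) →
      (∀ σ : absoluteGaloisGroup (v.adicCompletion K), ∃ z : W.geomPrimaryTorsion p,
        (∀ τ ∈ absInertia (v.adicCompletion K),
          GaloisRep.restrictField (v.adicCompletion K) (primaryGaloisModule W p) τ z = z) ∧
        GaloisRep.restrictField (v.adicCompletion K) (primaryGaloisModule W p) σ y - y = p ^ k • z) →
      ∃ m : W.geomPrimaryTorsion p,
        (∀ σ : absoluteGaloisGroup (v.adicCompletion K),
          GaloisRep.restrictField (v.adicCompletion K) (primaryGaloisModule W p) σ m = m) ∧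
        ∃ z : W.geomPrimaryTorsion p,
          (∀ τ ∈ absInertia (v.adicCompletion K),
            GaloisRep.restrictField (v.adicCompletion K) (primaryGaloisModule W p) τ z = z) ∧
          y - m = p ^ k • z)
    (𝓖 : SelmerStructure (W.torsionGaloisModule ((p ^ k : ℕ) : ℤ)))
    (h𝓖Q : ∀ v ∈ Q, 𝓖 (Sum.inr v) = W.kummerSelmerStructure ((p ^ k : ℕ) : ℤ) (Sum.inr v) ⊔
      unramifiedSubgroup (GaloisRep.toLocal v (W.torsionGaloisModule ((p ^ k : ℕ) : ℤ))) 1)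
    (h𝓖nQ : ∀ v ∉ Q, 𝓖 (Sum.inr v) = W.kummerSelmerStructure ((p ^ k : ℕ) : ℤ) (Sum.inr v))
    (h𝓖inl : ∀ w : InfinitePlace K, 𝓖 (Sum.inl w) = W.kummerSelmerStructure ((p ^ k : ℕ) : ℤ) (Sum.inl w))
    (S : AddSubgroup (W.galH1Primary p))
    (hS : ∀ x, x ∈ S ↔
      (∀ v : HeightOneSpectrum (𝓞 K), v ∉ Q → x ∈ selmerLocalKerPrimary W (v.adicCompletion K) p) ∧
      (∀ w : InfinitePlace K, x ∈ selmerLocalKerPrimary W w.Completion p) ∧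
      (∀ v ∈ Q, galoisCohomology.localization (primaryGaloisModule W p) (Sum.inr v) 1 x ∈
        unramifiedSubgroup (GaloisRep.toLocal v (primaryGaloisModule W p)) 1)) :
    𝓖.selmerGroup = S.comap
      (galoisCohomology.map (primaryInclusion W p k) 1 : galH1Torsion W ((p ^ k : ℕ) : ℤ) →+ W.galH1Primary p) := by
  ext y
  refine ((SelmerStructure.mem_selmerGroup_iff 𝓖 y).trans ?_).trans (hS _).symm
  -- the Kummer condition at a place, read on `ι_k y`
  have hkum : ∀ u : Place K,
      galoisCohomology.localization (W.torsionGaloisModule ((p ^ k : ℕ) : ℤ)) u 1 y ∈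
          W.kummerSelmerStructure ((p ^ k : ℕ) : ℤ) u ↔
        (galoisCohomology.map (primaryInclusion W p k) 1 : galH1Torsion W ((p ^ k : ℕ) : ℤ) →+ W.galH1Primary p) y ∈
          selmerLocalKerPrimary W (Place.Completion u) p := by
    intro u
    rw [map_primaryInclusion_mem_selmerLocalKerPrimary_iff]
    exact (SetLike.ext_iff.mp (W.comap_localization_kummerSelmerStructure ((p ^ k : ℕ) : ℤ) u) y)
  constructor
  · intro h
    refine ⟨fun v hv => ?_, fun w => ?_, fun v hv => ?_⟩
    · have h' := h (Sum.inr v); rw [h𝓖nQ v hv, hkum] at h'; exact h'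
    · have h' := h (Sum.inl w); rw [h𝓖inl w, hkum] at h'; exact h'
    · have h' := h (Sum.inr v); rw [h𝓖Q v hv] at h'
      exact (localization_mem_kummer_sup_unramified_iff_of_lift W p k v (hQp v hv) (hliftk v hv) y).1 h'
  · rintro ⟨hfin, hinf, hQ⟩ u
    rcases u with w | v
    · rw [h𝓖inl w, hkum]; exact hinf w
    · by_cases hv : v ∈ Q
      · rw [h𝓖Q v hv]
        exact (localization_mem_kummer_sup_unramified_iff_of_lift W p k v (hQp v hv) (hliftk v hv) y).2 (hQ v hv)
      · rw [h𝓖nQ v hv, hkum]; exact hfin v hv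

/-! ## §4 Part 26 §4′: `[S_Σ ⊓ im ι_k : Sel_{p^∞} ⊓ …] · [Sel^{(p^k)} : H¹_{𝓚⊓ur@Σ}] = ∏_{v∈Σ} p^{v_p(c_v)}` for `k ≫ 0` -/

/-- **(R1-d), discrete side moved to `E[p^∞]`, reduction-type-free at `Σ`**: for an elliptic curve over a number field `K : Type`, `p`
odd, finite sets `Σ ⊆ T` of finite places `∤ p` carrying binders (I) and (L) (`T ⊇ {v ∣ p} ∪ {bad}`), and ANY subgroup
`S_Σ ≤ H¹(K, E[p^∞])` cut out by «`p^∞`-Selmer local kernel off `Σ`, unramified at `Σ`»: `∃ k₀ ≥ 1, ∀ k ≥ k₀`, for all Selmer structures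
`𝓖` («`𝓚 ⊔ H¹_ur` at `Σ`, `𝓚` elsewhere») and `𝓖'` («`𝓚 ⊓ H¹_ur` at `Σ`, `𝓚` elsewhere») on `E[p^k]`: `H¹_𝓖 = ι_k⁻¹ S_Σ`, and
`[S_Σ ⊓ im ι_k : Sel_{p^∞} ⊓ (S_Σ ⊓ im ι_k)] · [Sel^{(p^k)}(E/K) : H¹_{𝓖'}(K, E[p^k])] = ∏_{v∈Σ} p^{v_p(c_v)}`. Part 26 §4 verbatim.
[cite: Rubin2000, Thm. 1.7.3] [cite: Kato2004Asterisque, §14.8 (p. 238) and (14.9.3) (p. 240)] [cite: GreenbergLNM1716, §5 (p. 114)] -/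
theorem exists_forall_le_relIndex_selmerGroupPInfty_mul_relIndex_eq_of_local (hodd : p ≠ 2)
    (Q T : Finset (HeightOneSpectrum (𝓞 K))) (hQT : Q ⊆ T)
    (hQp : ∀ v ∈ Q, ((p : ℕ) : 𝓞 K) ∉ v.asIdeal)
    (hidx : ∀ v ∈ Q, ∃ k₁ : ℕ, ∀ k, k₁ ≤ k →
      (W.kummerSelmerStructure ((p ^ k : ℕ) : ℤ) (Sum.inr v)).relIndex
          (W.kummerSelmerStructure ((p ^ k : ℕ) : ℤ) (Sum.inr v) ⊔
            unramifiedSubgroup (GaloisRep.toLocal v (W.torsionGaloisModule ((p ^ k : ℕ) : ℤ))) 1) =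
        p ^ padicValNat p ((W.baseChange (v.adicCompletion K)).localTamagawaNumber (v.adicCompletionIntegers K)))
    (hlift : ∀ v ∈ Q, ∃ k₂ : ℕ, ∀ k, k₂ ≤ k → ∀ y : W.geomPrimaryTorsion p,
      (∀ τ ∈ absInertia (v.adicCompletion K),
        GaloisRep.restrictField (v.adicCompletion K) (primaryGaloisModule W p) τ y = y) →
      (∀ σ : absoluteGaloisGroup (v.adicCompletion K), ∃ z : W.geomPrimaryTorsion p,
        (∀ τ ∈ absInertia (v.adicCompletion K),
          GaloisRep.restrictField (v.adicCompletion K) (primaryGaloisModule W p) τ z = z) ∧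
        GaloisRep.restrictField (v.adicCompletion K) (primaryGaloisModule W p) σ y - y = p ^ k • z) →
      ∃ m : W.geomPrimaryTorsion p,
        (∀ σ : absoluteGaloisGroup (v.adicCompletion K),
          GaloisRep.restrictField (v.adicCompletion K) (primaryGaloisModule W p) σ m = m) ∧
        ∃ z : W.geomPrimaryTorsion p,
          (∀ τ ∈ absInertia (v.adicCompletion K),
            GaloisRep.restrictField (v.adicCompletion K) (primaryGaloisModule W p) τ z = z) ∧
          y - m = p ^ k • z)
    (hTp : ∀ v : HeightOneSpectrum (𝓞 K), ((p : ℕ) : 𝓞 K) ∈ v.asIdeal → v ∈ T)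
    (hTbad : ∀ v : HeightOneSpectrum (𝓞 K), ¬ W.HasGoodReductionAt v → v ∈ T)
    (S : AddSubgroup (W.galH1Primary p))
    (hS : ∀ x, x ∈ S ↔
      (∀ v : HeightOneSpectrum (𝓞 K), v ∉ Q → x ∈ selmerLocalKerPrimary W (v.adicCompletion K) p) ∧
      (∀ w : InfinitePlace K, x ∈ selmerLocalKerPrimary W w.Completion p) ∧
      (∀ v ∈ Q, galoisCohomology.localization (primaryGaloisModule W p) (Sum.inr v) 1 x ∈
        unramifiedSubgroup (GaloisRep.toLocal v (primaryGaloisModule W p)) 1)) :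
    ∃ k₀ : ℕ, 1 ≤ k₀ ∧ ∀ k, k₀ ≤ k →
      ∀ (𝓖 𝓖' : SelmerStructure (W.torsionGaloisModule ((p ^ k : ℕ) : ℤ))),
        (∀ v ∈ Q, 𝓖 (Sum.inr v) = W.kummerSelmerStructure ((p ^ k : ℕ) : ℤ) (Sum.inr v) ⊔
          unramifiedSubgroup (GaloisRep.toLocal v (W.torsionGaloisModule ((p ^ k : ℕ) : ℤ))) 1) →
        (∀ v ∉ Q, 𝓖 (Sum.inr v) = W.kummerSelmerStructure ((p ^ k : ℕ) : ℤ) (Sum.inr v)) →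
        (∀ w : InfinitePlace K, 𝓖 (Sum.inl w) = W.kummerSelmerStructure ((p ^ k : ℕ) : ℤ) (Sum.inl w)) →
        (∀ v ∈ Q, 𝓖' (Sum.inr v) = W.kummerSelmerStructure ((p ^ k : ℕ) : ℤ) (Sum.inr v) ⊓
          unramifiedSubgroup (GaloisRep.toLocal v (W.torsionGaloisModule ((p ^ k : ℕ) : ℤ))) 1) →
        (∀ v ∉ Q, 𝓖' (Sum.inr v) = W.kummerSelmerStructure ((p ^ k : ℕ) : ℤ) (Sum.inr v)) →
        (∀ w : InfinitePlace K, 𝓖' (Sum.inl w) = W.kummerSelmerStructure ((p ^ k : ℕ) : ℤ) (Sum.inl w)) →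
        𝓖.selmerGroup = S.comap (galoisCohomology.map (primaryInclusion W p k) 1 : galH1Torsion W ((p ^ k : ℕ) : ℤ) →+ W.galH1Primary p) ∧
        (selmerGroupPInfty W p).relIndex
              (S ⊓ (galoisCohomology.map (primaryInclusion W p k) 1 : galH1Torsion W ((p ^ k : ℕ) : ℤ) →+ W.galH1Primary p).range) *
            𝓖'.selmerGroup.relIndex (W.kummerSelmerStructure ((p ^ k : ℕ) : ℤ)).selmerGroup =
          ∏ v ∈ Q, p ^ padicValNat p
            ((W.baseChange (v.adicCompletion K)).localTamagawaNumber (v.adicCompletionIntegers K)) := by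
  classical
  obtain ⟨k₀, hk₀, h⟩ := exists_forall_le_relIndex_selmerGroup_eq_prod_of_local W p hodd Q T hQT hQp hidx hTp hTbad
  -- one threshold for the door lifts at all `v ∈ Q`
  choose! g hg using hlift
  refine ⟨max k₀ (Q.sup g), le_trans hk₀ (le_max_left _ _), fun k hk 𝓖 𝓖' h𝓖Q h𝓖nQ h𝓖inl h𝓖'Q h𝓖'nQ h𝓖'inl => ?_⟩
  have hliftk := fun v (hv : v ∈ Q) => hg v hv k ((Finset.le_sup hv).trans ((le_max_right _ _).trans hk))
  have hcomap := selmerGroup_kummerSupUnramified_eq_comap_of_lift W p k Q hQp hliftk 𝓖 h𝓖Q h𝓖nQ h𝓖inl S hS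
  refine ⟨hcomap, ?_⟩
  obtain ⟨hle', hidx'⟩ := h k ((le_max_left _ _).trans hk) 𝓖 𝓖' h𝓖Q h𝓖nQ h𝓖'Q h𝓖'nQ (fun w => by rw [h𝓖inl w, h𝓖'inl w])
  -- `H¹_{𝓖'} ≤ H¹_𝓚 ≤ H¹_𝓖`
  have hle₁ : 𝓖'.selmerGroup ≤ (W.kummerSelmerStructure ((p ^ k : ℕ) : ℤ)).selmerGroup := fun x hx => by
    rw [SelmerStructure.mem_selmerGroup_iff] at hx ⊢
    intro u
    rcases u with w | v
    · rw [← h𝓖'inl w]; exact hx _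
    · by_cases hv : v ∈ Q
      · have h' := hx (Sum.inr v); rw [h𝓖'Q v hv] at h'; exact h'.1
      · rw [← h𝓖'nQ v hv]; exact hx _
  have hle₂ : (W.kummerSelmerStructure ((p ^ k : ℕ) : ℤ)).selmerGroup ≤ 𝓖.selmerGroup := fun x hx => by
    rw [SelmerStructure.mem_selmerGroup_iff] at hx ⊢
    intro u
    rcases u with w | v
    · rw [h𝓖inl w]; exact hx _
    · by_cases hv : v ∈ Q
      · rw [h𝓖Q v hv]; exact AddSubgroup.mem_sup_left (hx _)
      · rw [h𝓖nQ v hv]; exact hx _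
  rw [← relIndex_selmerGroup_kummer_eq_relIndex_selmerGroupPInfty W p k 𝓖 S hcomap, mul_comm,
    AddSubgroup.relIndex_mul_relIndex _ _ _ hle₁ hle₂]
  exact hidx'

end Summit.BirchSwinnertonDyer.BirchSwinnertonDyer.Theorems.ErratumRoadFiveKatoFframeKummerUnramifiedBad

end
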